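import Mathlib.RingTheory.AdjoinRoot
import Mathlib.Tactic.ComputeDegree
import Summits.QuantumAdvantage.AdviceFreeQNC0.WalkTransport
import HarnessLib

/-!
# Cell qa-qnc0 (rung F-Q1, route RingFrame, crux α `RingToElim`): the `𝔽₄`-characters of the
# walk game — the field `𝔽₄`, path characters, the multiplication rule, Frobenius

Planner qa-qnc0-p1's `𝔽₄`-Hadamard picture (TARGET §15.1), made kernel as the toolkit for the
FULL EXACT LAW (`WalkExactLaw.lean`) and the fail floor of the density axis (`WalkFailFloor.lean`).

Setting.  `𝔽₄ = 𝔽₂[X]/(X²+X+1)` (`F4`, via `AdjoinRoot`), `ω` the class of `X`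
(`ω² + ω + 1 = 0`, `ω³ = 1`, `2 = 0`), trace `tr x = x + x²` (`tr ω^s = [s ≢ 0 (3)]`,
`F4.tr_omega_pow`; a natural number is its parity, `F4.natCast_eq`).  For a pattern
`a ∈ {1,2}^m` (coded `Fin m → Bool`, `false ↦ 1`, `true ↦ 2`) the character
`χ_a(u) = ω^{Σ aᵢuᵢ}` (`chi`); the walk character of cut `g` is `ω^{|u| + |u_{<g}|} = χ_{a^{(g)}}`
with the PATH pattern `a^{(g)} = 2^g 1^{m−g}` (`aPat`, `omega_pow_walkExp`).

* `ind_mul_chi` — the multiplication rule `uᵢ·χ_a = ω^{aᵢ}(χ_a + χ_{σᵢa})`; hence multiplying a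
  character by a monomial of degree `|T|` keeps the spectrum within Hamming distance `|T|`
  (`ind_mul_mem_chiSpan`, `mono_mul_chi_mem`; spans `chiSpan P` of characters with `P a`);
* `chi_sq`, `sq_mem_chiSpan` — Frobenius conjugates the spectrum (`χ_a² = χ_ā`).

The cell's lemmas (planner qa-qnc0-p1 gen 3, TARGET §15.1; prover qn-prover-3 gen 5), 2026-08-27;
standard character calculus, not in print in this form.  WHAT THIS IS NOT: no statement about the
game yet (see `WalkExactLaw.lean`, `WalkFailFloor.lean`); no separation claim.
-/

noncomputable section

namespace Summit.QuantumAdvantage.AdviceFreeQNC0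

open Finset Polynomial
open Literature.Computability.MetaComplexity Literature.Computability.MetaComplexity.Smolensky

/-! ### The field `𝔽₄` -/

/-- `𝔽₄ = 𝔽₂[X]/(X² + X + 1)`. -/
abbrev F4 : Type := AdjoinRoot (X ^ 2 + X + 1 : (ZMod 2)[X])

namespace F4

/-- `ω`, the class of `X`: a primitive cube root of unity. -/
def ω : F4 := AdjoinRoot.root (X ^ 2 + X + 1 : (ZMod 2)[X])

/-- `2 = 0` in `𝔽₄`. -/
theorem two_eq_zero : (2 : F4) = 0 := by
  have h : (algebraMap (ZMod 2) F4) 2 = (2 : F4) := map_ofNat _ 2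
  rw [← h, show (2 : ZMod 2) = 0 from rfl, map_zero]

/-- `ω + ω² = 1` (the defining relation `ω² + ω + 1 = 0` read in characteristic `2`). -/
theorem omega_add_omega_sq : ω + ω ^ 2 = 1 := by
  have h := AdjoinRoot.eval₂_root (X ^ 2 + X + 1 : (ZMod 2)[X])
  simp only [eval₂_add, eval₂_X_pow, eval₂_X, eval₂_one] at h
  have h' : ω ^ 2 + ω + 1 = 0 := h
  linear_combination h' - two_eq_zero

/-- `𝔽₄` is nontrivial. -/
theorem nontrivial : Nontrivial F4 := by
  refine AdjoinRoot.nontrivial _ ?_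
  have h : (X ^ 2 + X + 1 : (ZMod 2)[X]).degree = 2 := by compute_degree!
  rw [h]
  norm_num

/-- `x + x = 0`. -/
theorem add_self (x : F4) : x + x = 0 := by
  linear_combination x * two_eq_zero

/-- `−x = x`. -/
theorem neg_eq (x : F4) : -x = x := by
  linear_combination (-x) * two_eq_zero

/-- `(x + y)² = x² + y²`. -/
theorem add_sq' (x y : F4) : (x + y) ^ 2 = x ^ 2 + y ^ 2 := by
  linear_combination x * y * two_eq_zero

/-- `ω² = ω + 1`. -/
theorem omega_sq : ω ^ 2 = ω + 1 := by
  linear_combination omega_add_omega_sq - ω * two_eq_zero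

/-- `ω^m = ω^{m mod 3}` (as `ω³ = 1`). -/
theorem omega_pow_mod (m : ℕ) : ω ^ m = ω ^ (m % 3) := by
  have h3 : ω ^ 3 = 1 := by
    linear_combination (ω - 1) * omega_add_omega_sq + (ω - 1) * two_eq_zero
  conv_lhs => rw [← Nat.div_add_mod m 3, pow_add, pow_mul, h3, one_pow, one_mul]

/-- `1 + ω = ω²`. -/
theorem one_add_omega : 1 + ω = ω ^ 2 := by
  linear_combination -omega_add_omega_sq + ω * two_eq_zero

/-- `1 + ω² = ω`. -/
theorem one_add_omega_sq : 1 + ω ^ 2 = ω := by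
  linear_combination omega_add_omega_sq + (1 - ω) * two_eq_zero

/-- Powers of `ω` are units (`ω^k · ω^{2k} = ω^{3k} = 1`). -/
theorem isUnit_omega_pow (k : ℕ) : IsUnit (ω ^ k) :=
  isUnit_iff_exists_inv.2 ⟨ω ^ (2 * k), by
    rw [← pow_add, show k + 2 * k = 3 * k by ring, omega_pow_mod, Nat.mul_mod_right, pow_zero]⟩

/-- The trace `tr x = x + x²` (`𝔽₄ → 𝔽₂ ⊂ 𝔽₄`). -/
def tr (x : F4) : F4 := x + x ^ 2

/-- `tr` is additive. -/
theorem tr_add (x y : F4) : tr (x + y) = tr x + tr y := by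
  unfold tr; rw [add_sq']; ring

/-- `tr 0 = 0`. -/
theorem tr_zero : tr 0 = 0 := by unfold tr; ring

/-- `tr` of a finite sum. -/
theorem tr_sum {ι : Type*} (s : Finset ι) (f : ι → F4) : tr (∑ i ∈ s, f i) = ∑ i ∈ s, tr (f i) := by
  classical
  induction s using Finset.induction_on with
  | empty => rw [Finset.sum_empty, Finset.sum_empty, tr_zero]
  | insert a s ha ih => rw [Finset.sum_insert ha, Finset.sum_insert ha, tr_add, ih]

/-- `tr (ω^s) = [s ≢ 0 (mod 3)]`. -/
theorem tr_omega_pow (s : ℕ) : tr (ω ^ s) = if s % 3 = 0 then 0 else 1 := by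
  unfold tr
  rw [omega_pow_mod s, ← pow_mul]
  have hs : s % 3 = 0 ∨ s % 3 = 1 ∨ s % 3 = 2 := by omega
  rcases hs with h | h | h <;> rw [h]
  · simp [add_self]
  · rw [if_neg (by norm_num), pow_one, show 1 * 2 = 2 from rfl, omega_add_omega_sq]
  · rw [if_neg (by norm_num), omega_pow_mod (2 * 2), show 2 * 2 % 3 = 1 from rfl, pow_one, add_comm,
      omega_add_omega_sq]

/-- A natural number cast into `𝔽₄` is its parity. -/
theorem natCast_eq (n : ℕ) : (n : F4) = if n % 2 = 1 then 1 else 0 := by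
  have h : (n : F4) = ((n % 2 : ℕ) : F4) := by
    conv_lhs => rw [← Nat.div_add_mod n 2]
    push_cast
    rw [two_eq_zero, zero_mul, zero_add]
  rw [h]
  have hn : n % 2 = 0 ∨ n % 2 = 1 := by omega
  rcases hn with h0 | h1
  · rw [h0, if_neg (by norm_num)]; exact Nat.cast_zero
  · rw [h1, if_pos rfl]; exact Nat.cast_one

end F4

open F4

/-! ### Characters -/

variable {m : ℕ}

/-- The exponent of a letter: `false ↦ 1`, `true ↦ 2`. -/
def lett (b : Bool) : ℕ := if b then 2 else 1

/-- The indicator `{false, true} ↦ {0, 1} ⊂ 𝔽₄`. -/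
def ιF (b : Bool) : F4 := if b then 1 else 0

/-- The character `χ_a(u) = ω^{Σᵢ aᵢ uᵢ}` of a pattern `a ∈ {1,2}^m`. -/
def chi (a : Fin m → Bool) (u : Fin m → Bool) : F4 := ∏ i, (if u i then ω ^ lett (a i) else 1)

/-- The path pattern `a^{(g)} = 2^g 1^{m−g}`. -/
def aPat (g : ℕ) : Fin m → Bool := fun i => decide (i.val < g)

/-- The conjugate pattern (letters `1 ↔ 2`). -/
def conj (a : Fin m → Bool) : Fin m → Bool := fun i => !a i

/-- Hamming distance of patterns. -/
def pdist (a b : Fin m → Bool) : ℕ := (univ.filter fun i => a i ≠ b i).card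

/-- **The walk character is a path character**: `ω^{|u| + |u_{<g}|} = χ_{a^{(g)}}(u)`. -/
theorem omega_pow_walkExp (u : Fin m → Bool) (g : ℕ) : ω ^ walkExp u g = chi (aPat g) u := by
  classical
  unfold walkExp wt wtPrefix chi
  rw [Finset.card_filter, Finset.card_filter, ← Finset.sum_add_distrib, ← Finset.prod_pow_eq_pow_sum]
  refine Finset.prod_congr rfl fun i _ => ?_
  unfold aPat lett
  by_cases hu : u i = true
  · by_cases hi : i.val < g
    · rw [if_pos hu, if_pos ⟨hi, hu⟩, if_pos hu, if_pos (decide_eq_true hi)]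
    · rw [if_pos hu, if_neg (fun h => hi h.1), if_pos hu, if_neg (by rw [decide_eq_true_iff]; exact hi)]
  · rw [if_neg hu, if_neg (fun h => hu h.2), if_neg hu, Nat.add_zero, pow_zero]

/-- `χ_a² = χ_ā`. -/
theorem chi_sq (a : Fin m → Bool) (u : Fin m → Bool) : chi a u ^ 2 = chi (conj a) u := by
  unfold chi conj
  rw [← Finset.prod_pow]
  refine Finset.prod_congr rfl fun i _ => ?_
  by_cases hu : u i = true
  · rw [if_pos hu, if_pos hu, ← pow_mul]
    unfold lett
    cases a i
    · simp only [Bool.false_eq_true, if_false, Bool.not_false, if_true, Nat.one_mul]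
    · simp only [if_true, Bool.not_true, Bool.false_eq_true, if_false]
      rw [omega_pow_mod (2 * 2), show 2 * 2 % 3 = 1 from rfl]
  · rw [if_neg hu, if_neg hu, one_pow]

/-- **The multiplication rule**: `uᵢ · χ_a(u) = ω^{aᵢ} · (χ_a(u) + χ_{σᵢ a}(u))`. -/
theorem ind_mul_chi (a : Fin m → Bool) (i : Fin m) (u : Fin m → Bool) :
    ιF (u i) * chi a u = ω ^ lett (a i) * (chi a u + chi (Function.update a i (!a i)) u) := by
  classical
  have split : ∀ c : Fin m → Bool, chi c u =
      (if u i = true then ω ^ lett (c i) else 1) * ∏ j ∈ univ.erase i, (if u j = true then ω ^ lett (c j) else 1) :=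
    fun c => (Finset.mul_prod_erase univ (fun j => if u j = true then ω ^ lett (c j) else 1)
      (Finset.mem_univ i)).symm
  have hrest : ∏ j ∈ univ.erase i, (if u j = true then ω ^ lett (Function.update a i (!a i) j) else 1) =
      ∏ j ∈ univ.erase i, (if u j = true then ω ^ lett (a j) else 1) :=
    Finset.prod_congr rfl fun j hj => by rw [Function.update_of_ne (Finset.ne_of_mem_erase hj)]
  rw [split a, split (Function.update a i (!a i)), hrest, Function.update_self]
  set R := ∏ j ∈ univ.erase i, (if u j = true then ω ^ lett (a j) else 1) with hR
  unfold ιF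
  by_cases hu : u i = true
  · rw [if_pos hu, if_pos hu, if_pos hu]
    unfold lett
    cases a i
    · simp only [Bool.false_eq_true, if_false, Bool.not_false, if_true]
      linear_combination (-(ω * R)) * omega_add_omega_sq
    · simp only [if_true, Bool.not_true, Bool.false_eq_true, if_false]
      linear_combination (-(ω ^ 2 * R)) * omega_add_omega_sq
  · rw [if_neg hu, if_neg hu, if_neg hu]
    linear_combination (-(ω ^ lett (a i) * R)) * two_eq_zero

/-! ### Spans of characters -/

/-- The `𝔽₄`-span of the characters `χ_a` with `P a`. -/
def chiSpan (P : (Fin m → Bool) → Prop) : Submodule F4 ((Fin m → Bool) → F4) :=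
  Submodule.span F4 {f | ∃ a, P a ∧ f = chi a}

/-- Generators lie in the span. -/
theorem chi_mem_chiSpan {P : (Fin m → Bool) → Prop} {a : Fin m → Bool} (h : P a) :
    chi a ∈ chiSpan P :=
  Submodule.subset_span ⟨a, h, rfl⟩

/-- Monotonicity in the predicate. -/
theorem chiSpan_mono {P Q : (Fin m → Bool) → Prop} (h : ∀ a, P a → Q a) : chiSpan P ≤ chiSpan Q := by
  refine Submodule.span_mono ?_
  rintro f ⟨a, ha, rfl⟩
  exact ⟨a, h a ha, rfl⟩

/-- Hamming distance after one letter flip grows by at most one. -/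
theorem pdist_update_le (a b : Fin m → Bool) (i : Fin m) :
    pdist (Function.update a i (!a i)) b ≤ pdist a b + 1 := by
  classical
  unfold pdist
  have hsub : (univ.filter fun j => Function.update a i (!a i) j ≠ b j) ⊆
      insert i (univ.filter fun j => a j ≠ b j) := by
    intro j hj
    rw [Finset.mem_insert]
    by_cases hji : j = i
    · exact Or.inl hji
    · right
      rw [Finset.mem_filter] at hj ⊢
      rw [Function.update_of_ne hji] at hj
      exact hj
  exact le_trans (Finset.card_le_card hsub) (Finset.card_insert_le _ _)

/-- **Multiplying by `uᵢ` moves the spectrum by at most one letter.** -/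
theorem ind_mul_mem_chiSpan (b : Fin m → Bool) (i : Fin m) (k : ℕ) {f : (Fin m → Bool) → F4}
    (hf : f ∈ chiSpan fun a => pdist a b ≤ k) :
    (fun u => ιF (u i) * f u) ∈ chiSpan fun a => pdist a b ≤ k + 1 := by
  unfold chiSpan at hf
  induction hf using Submodule.span_induction with
  | mem g hg =>
    obtain ⟨a, ha, rfl⟩ := hg
    have e : (fun u => ιF (u i) * chi a u) =
        ω ^ lett (a i) • (chi a + chi (Function.update a i (!a i))) := by
      funext u
      rw [ind_mul_chi, Pi.smul_apply, Pi.add_apply, smul_eq_mul]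
    rw [e]
    refine Submodule.smul_mem _ _ (Submodule.add_mem _ (chi_mem_chiSpan (by omega)) ?_)
    exact chi_mem_chiSpan (le_trans (pdist_update_le a b i) (by omega))
  | zero =>
    have e : (fun u : Fin m → Bool => ιF (u i) * (0 : (Fin m → Bool) → F4) u) = 0 := by
      funext u; simp
    rw [e]; exact Submodule.zero_mem _
  | add g h _ _ hg hh =>
    have e : (fun u => ιF (u i) * (g + h) u) = (fun u => ιF (u i) * g u) + fun u => ιF (u i) * h u := by
      funext u; simp [mul_add]
    rw [e]; exact Submodule.add_mem _ hg hh
  | smul c g _ hg =>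
    have e : (fun u => ιF (u i) * (c • g) u) = c • fun u => ιF (u i) * g u := by
      funext u; simp [smul_eq_mul]; ring
    rw [e]; exact Submodule.smul_mem _ _ hg

/-- The `𝔽₄`-monomial `Πᵢ∈T uᵢ`. -/
def monoF (T : Finset (Fin m)) (u : Fin m → Bool) : F4 := ∏ i ∈ T, ιF (u i)

/-- **A monomial of degree `|T|` times a character has spectrum within distance `|T|`.** -/
theorem mono_mul_chi_mem (T : Finset (Fin m)) (b : Fin m → Bool) :
    (fun u => monoF T u * chi b u) ∈ chiSpan fun a => pdist a b ≤ T.card := by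
  classical
  induction T using Finset.induction_on with
  | empty =>
    have e : (fun u => monoF (∅ : Finset (Fin m)) u * chi b u) = chi b := by
      funext u; simp [monoF]
    rw [e]
    exact chi_mem_chiSpan (by simp [pdist])
  | insert i T hi ih =>
    have e : (fun u => monoF (insert i T) u * chi b u) = fun u => ιF (u i) * (monoF T u * chi b u) := by
      funext u; unfold monoF; rw [Finset.prod_insert hi, mul_assoc]
    rw [e, Finset.card_insert_of_notMem hi]
    exact ind_mul_mem_chiSpan b i T.card ih

/-- **Frobenius conjugates the spectrum**: `f ∈ span{χ_a : P a}` ⇒ `f² ∈ span{χ_a : P ā}`. -/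
theorem sq_mem_chiSpan {P : (Fin m → Bool) → Prop} {f : (Fin m → Bool) → F4} (hf : f ∈ chiSpan P) :
    (fun u => f u ^ 2) ∈ chiSpan fun a => P (conj a) := by
  unfold chiSpan at hf
  induction hf using Submodule.span_induction with
  | mem g hg =>
    obtain ⟨a, ha, rfl⟩ := hg
    have e : (fun u => chi a u ^ 2) = chi (conj a) := by funext u; exact chi_sq a u
    rw [e]
    refine chi_mem_chiSpan ?_
    have hcc : conj (conj a) = a := by funext i; simp [conj]
    rw [hcc]; exact ha
  | zero =>
    have e : (fun u : Fin m → Bool => (0 : (Fin m → Bool) → F4) u ^ 2) = 0 := by funext u; simp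
    rw [e]; exact Submodule.zero_mem _
  | add g h _ _ hg hh =>
    have e : (fun u => (g + h) u ^ 2) = (fun u => g u ^ 2) + fun u => h u ^ 2 := by
      funext u; simp [add_sq']
    rw [e]; exact Submodule.add_mem _ hg hh
  | smul c g _ hg =>
    have e : (fun u => (c • g) u ^ 2) = c ^ 2 • fun u => g u ^ 2 := by
      funext u; simp [smul_eq_mul, mul_pow]
    rw [e]; exact Submodule.smul_mem _ _ hg

end Summit.QuantumAdvantage.AdviceFreeQNC0

end
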